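import Mathlib
import Summits.NavierStokesRegularity.NavierStokesRegularity.Theorems.TypeIQuarterGateScarEnvelopeTypeISatelliteTowerLevelClosure

/-!
# Satellite tower for crux `ScarEnvelopeTypeI` (stmt-NavierStokesRegularity-23843) — Part S4–S6: the energy-graded critical scar rate `M_c(I)` is ATTAINED; global (S∞) ⟺ the profile attains its infimum

Part S4–S6 of nsreg-p3's ROUND-38 artefact (section `Level`): S4 `TNode.level`, `levelRates I`, `levelCrit I = M_c(I)`, `levelCrit_antitone`,
`epsL_le_levelCrit`, `critRate_le_levelCrit`, `exists_level_of_mem_singRates`, `exists_rootObj_of_mem_levelRates`; S5 ★★★ `levelCrit_attained`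
/ `levelCrit_exact` / `levelCrit_mem` (at every finite energy level carrying a scar the level critical rate is ATTAINED by a ROOT object of
class `M_c(I)` and level `≤ I`, all scars tight-rated exactly `M_c(I)` — (S∞) in energy-graded form, UNCONDITIONAL); S6 ★★
`critAttained_iff_levelCrit`, `not_critAttained_iff` (energy escape), `critRate_eq_iInf_levelCrit`, ★★★ `exactCritical_of_not_scarEnvelopeTypeI`
(if 23843 fails, at the finite energy level of the violating object there is an EXACTLY-CRITICAL ROOT OBJECT of class `M_c(I₀) ∈ [ε_L, M]`).

PROVENANCE: declaration texts VERBATIM from the HOME artefact of the instrument seat nsreg-p3 g27 (cell `pub/ns-regularity-ideate`):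
`round-38/CritRate38.lean` (sha16 `30eed4aabab5065a`, a standalone module written against the TREE; memo `round-38/ROUND-38.md`
4eff55037f29b2fe), scored by referee ref3 g27 (`SCORE-p3-ROUND-38-0828.md`); the author cannot write under `Theorems/`
(`perm.theorems-prover-only`); landed by the prover ns-es-p1 g5 as landing hand of record (director-ns DIRECTOR-NS #237 (3)), split into
≤ 400-line modules, `E3` spelled out, the artefact's `#guard_msgs … #print axioms` certificates not landed.
`--supports stmt-NavierStokesRegularity-23843 --as helper`.

HONEST FRAMING: instrument theorems about HYPOTHETICAL Type-I zoom limits (Albritton–Barker objects of the census of crux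
`TypeIQuarterGate.ScarEnvelopeTypeI`, item 23843); the analytic input is the tree's closure engine (compactness
`local_typeI_compactness_twin_inBall`, sharpened to constant 1 in Part S1; Q1 whole-space), P1 rate inheritance, L8 persistence and the
tree's PROVED small-constant Liouville theorem; Parts R/S are order theory on the re-classing and closure lemmas.  NOTHING OPEN IS
PROVED: 23843, (L′) `TypeILiouvilleAB` / (L′₀), the GLOBAL (S∞) = `CritAttained`, (M𝐈₁), (E1⁺), (E2ᵣ), route ExtremalTypeIConstant's
cruxes, N0 and Navier–Stokes regularity are OPEN; `critRate`, `levelCrit I`, `liouvilleRate` are `sInf`s that are `0` by junk value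
when the defining set is empty (every statement using them carries the nonemptiness hypothesis explicitly).
-/

-- the summit-side namespace repeats a component by design (single-conjunct summit, D-0017)
set_option linter.dupNamespace false

open MeasureTheory Set Metric Filter Topology
open scoped ENNReal NNReal InnerProductSpace
open Literature.Analysis.FluidPDE

namespace Summit.NavierStokesRegularity.NavierStokesRegularity.Cruxes.ScarEnvelopeTypeI.ZoomDictionary

section Level

variable {U : ℝ → (EuclideanSpace ℝ (Fin 3)) → (EuclideanSpace ℝ (Fin 3))} {P : ℝ → (EuclideanSpace ℝ (Fin 3)) → ℝ}

/-! ### S4. The level of a node; the scar rates and the critical rate AT AN ENERGY LEVEL -/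

/-- The ENERGY LEVEL of a node: its Type-I energy `𝐈` on the backward slab. -/
noncomputable def TNode.level (n : TNode) : ℝ≥0∞ := typeIBound (Iio (0 : ℝ) ×ˢ univ) n.U n.P n.H

/-- The scar rates realised by A–B objects (of any class) of ENERGY LEVEL `≤ I`. -/
def levelRates (I : ℝ≥0∞) : Set ℝ :=
  {r | ∃ (M : ℝ) (n : TNode) (y : (EuclideanSpace ℝ (Fin 3))), ABTower M n.U n.P n.H ∧ n.level ≤ I ∧ ¬ RegPt n.U y ∧
    r = tightRate n.U y}

/-- ★ The **LEVEL-`I` CRITICAL SCAR RATE** `M_c(I) := inf (levelRates I)` (`= 0` by junk value if no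
A–B object of level `≤ I` carries a scar). -/
noncomputable def levelCrit (I : ℝ≥0∞) : ℝ := sInf (levelRates I)

/-- `levelRates I` is bounded below (by `0`). -/
theorem levelRates_bddBelow (I : ℝ≥0∞) : BddBelow (levelRates I) :=
  ⟨0, fun _ ⟨_, _, y, hAB, _, _, hr⟩ => hr ▸ tightRate_nonneg (towerObj_of_abTower hAB) y⟩

/-- `levelRates` is monotone in the level `I`. -/
theorem levelRates_mono {I J : ℝ≥0∞} (h : I ≤ J) : levelRates I ⊆ levelRates J :=
  fun _ ⟨M, n, y, hAB, hI, hy, hr⟩ => ⟨M, n, y, hAB, hI.trans h, hy, hr⟩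

/-- A level-`I` scar rate is a scar rate of its own class. -/
theorem levelRates_subset_singRates {I : ℝ≥0∞} {r : ℝ} (hr : r ∈ levelRates I) :
    ∃ M : ℝ, r ∈ singRates M := by
  obtain ⟨M, n, y, hAB, -, hy, rfl⟩ := hr
  exact ⟨M, n.U, n.P, n.H, y, hAB, hy, rfl⟩

/-- `M_c(I) ≤ r` for every level-`I` scar rate `r`. -/
theorem levelCrit_le {I : ℝ≥0∞} {r : ℝ} (hr : r ∈ levelRates I) : levelCrit I ≤ r :=
  csInf_le (levelRates_bddBelow I) hr

/-- The level profile `I ↦ M_c(I)` is NON-INCREASING (on the levels that carry scars). -/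
theorem levelCrit_antitone {I J : ℝ≥0∞} (h : I ≤ J) (hne : (levelRates I).Nonempty) :
    levelCrit J ≤ levelCrit I :=
  csInf_le_csInf (levelRates_bddBelow J) hne (levelRates_mono h)

/-- `ε_L ≤ M_c(I)` whenever level `I` carries a scar. -/
theorem epsL_le_levelCrit {I : ℝ≥0∞} (hne : (levelRates I).Nonempty) : epsL ≤ levelCrit I :=
  le_csInf hne fun _ ⟨_, _, _, hAB, _, hy, hr⟩ => hr ▸ hAB.epsL_le_tightRate' hy

/-- The global critical rate lies below every level critical rate. -/
theorem critRate_le_levelCrit {I : ℝ≥0∞} (hne : (levelRates I).Nonempty) : critRate ≤ levelCrit I :=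
  le_csInf hne fun _ hr => by
    obtain ⟨M, hM⟩ := levelRates_subset_singRates hr
    exact critRate_le_of_mem hM

/-- Every scar rate of some class is a scar rate at some finite level (the level of its object). -/
theorem exists_level_of_mem_singRates {M r : ℝ} (hr : r ∈ singRates M) :
    ∃ I : ℝ≥0∞, I < ⊤ ∧ r ∈ levelRates I := by
  obtain ⟨U, P, H, y, hAB, hy, rfl⟩ := hr
  exact ⟨typeIBound (Iio (0 : ℝ) ×ˢ univ) U P H, hAB.2.2.2,
    ⟨M, ⟨U, P, H, 0⟩, y, hAB, le_rfl, hy, rfl⟩⟩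

/-- ★ Re-classing INSIDE the level (S3): a level-`I` scar rate `r` is the class of a ROOT object of
level `≤ I`. -/
theorem exists_rootObj_of_mem_levelRates {I : ℝ≥0∞} {r : ℝ} (hr : r ∈ levelRates I) :
    ∃ n : TNode, RootObj r n ∧ n.level ≤ I := by
  obtain ⟨M, n, y, hAB, hI, hy, rfl⟩ := hr
  obtain ⟨U', P', H', hAB', hI', h0⟩ := hAB.reclass_level y
  exact ⟨⟨U', P', H', 0⟩, ⟨hAB', h0 hy⟩, hI'.trans hI⟩

/-! ### S5. ★★★ THE LEVEL CRITICAL RATE IS ATTAINED — (S∞) IN ENERGY-GRADED FORM, UNCONDITIONALLY -/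

/-- ★★★ **S5a. ATTAINMENT.**  If some A–B object of finite level `≤ I` carries a scar, then there is a
ROOT object OF CLASS `M_c(I)` and level `≤ I`.  (Minimising sequence of level-`I` scar rates
`r_k ↓ M_c(I)`; re-class each inside the level (S3); pass to the limit inside the level (S2'): the
energy hypothesis of R8 is AUTOMATIC because no step raises `𝐈`.) -/
theorem levelCrit_attained {I : ℝ≥0∞} (hI : I < ⊤) (hne : (levelRates I).Nonempty) :
    ∃ n : TNode, RootObj (levelCrit I) n ∧ n.level ≤ I := by
  -- a minimising sequence of level-`I` scar rates
  have hr : ∀ k : ℕ, ∃ r ∈ levelRates I, r < levelCrit I + 1 / ((k : ℝ) + 1) := fun k =>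
    (csInf_lt_iff (levelRates_bddBelow I) hne).1 (lt_add_of_pos_right _ (by positivity))
  choose r hrmem hrlt using hr
  have hn : ∀ k, ∃ n : TNode, RootObj (r k) n ∧ n.level ≤ I := fun k =>
    exists_rootObj_of_mem_levelRates (hrmem k)
  choose n hnroot hnlev using hn
  have hlim : Tendsto r atTop (𝓝 (levelCrit I)) := by
    have hup : Tendsto (fun k : ℕ => levelCrit I + 1 / ((k : ℝ) + 1)) atTop (𝓝 (levelCrit I)) := by
      simpa using tendsto_const_nhds.add (tendsto_one_div_add_atTop_nhds_zero_nat (𝕜 := ℝ))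
    exact tendsto_of_tendsto_of_tendsto_of_le_of_le tendsto_const_nhds hup
      (fun k => levelCrit_le (hrmem k)) fun k => (hrlt k).le
  obtain ⟨n', hn', hI'⟩ := exists_rootObj_of_tendsto_sharp hI n hnroot hnlev hlim
  exact ⟨n', hn', hI'⟩

/-- ★★★ **S5b. THE EXACTLY-CRITICAL OBJECT OF THE LEVEL.**  The attained object is EXACTLY
`M_c(I)`-rated at EVERY one of its scars (it has at least one, at the origin): `tightRate = M_c(I)`
— the class bound from above, level-minimality from below. -/
theorem levelCrit_exact {I : ℝ≥0∞} (hI : I < ⊤) (hne : (levelRates I).Nonempty) :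
    ∃ n : TNode, RootObj (levelCrit I) n ∧ n.level ≤ I ∧
      ∀ y : (EuclideanSpace ℝ (Fin 3)), ¬ RegPt n.U y → tightRate n.U y = levelCrit I := by
  obtain ⟨n, hn, hIn⟩ := levelCrit_attained hI hne
  refine ⟨n, hn, hIn, fun y hy => le_antisymm ((towerObj_of_abTower hn.1).tightRate_le y) ?_⟩
  exact levelCrit_le ⟨_, n, y, hn.1, hIn, hy, rfl⟩

/-- S5c. In particular the level critical rate is itself a level scar rate (a minimum, not an inf). -/
theorem levelCrit_mem {I : ℝ≥0∞} (hI : I < ⊤) (hne : (levelRates I).Nonempty) :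
    levelCrit I ∈ levelRates I := by
  obtain ⟨n, hn, hIn, hex⟩ := levelCrit_exact hI hne
  exact ⟨_, n, 0, hn.1, hIn, hn.2, (hex 0 hn.2).symm⟩

/-! ### S6. The global (S∞) ⟺ the level profile attains its infimum; the summit object -/

/-- ★★ **S6a.** `CritAttained` (the global (S∞) of R4) holds IFF the non-increasing level profile
`I ↦ M_c(I)` takes the value `M_c` at some FINITE level. -/
theorem critAttained_iff_levelCrit :
    CritAttained ↔ ∃ I : ℝ≥0∞, I < ⊤ ∧ (levelRates I).Nonempty ∧ levelCrit I = critRate := by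
  constructor
  · rintro ⟨r, U, P, H, y, hAB, hy, hr⟩
    obtain ⟨I, hI, hmem⟩ :=
      exists_level_of_mem_singRates (M := critRate) ⟨U, P, H, y, hAB, hy, hr⟩
    refine ⟨I, hI, ⟨_, hmem⟩, le_antisymm ?_ (critRate_le_levelCrit ⟨_, hmem⟩)⟩
    refine (levelCrit_le hmem).trans ?_
    rw [hr]
    exact (towerObj_of_abTower hAB).tightRate_le y
  · rintro ⟨I, hI, hne, heq⟩
    obtain ⟨n, hn, -⟩ := levelCrit_attained hI hne
    rw [heq] at hn
    exact ⟨_, n.U, n.P, n.H, 0, hn.1, hn.2, rfl⟩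

/-- ★★ **S6b. ENERGY ESCAPE made quantitative.**  (S∞) FAILS iff the level profile stays STRICTLY
above `M_c` at every finite scar-carrying level (while `M_c = inf_I M_c(I)`). -/
theorem not_critAttained_iff :
    ¬ CritAttained ↔ ∀ I : ℝ≥0∞, I < ⊤ → (levelRates I).Nonempty → critRate < levelCrit I := by
  rw [critAttained_iff_levelCrit]
  constructor
  · intro h I hI hne
    exact lt_of_le_of_ne (critRate_le_levelCrit hne) fun heq => h ⟨I, hI, hne, heq.symm⟩
  · rintro h ⟨I, hI, hne, heq⟩
    exact (h I hI hne).ne' heq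

/-- `M_c` is the infimum of the level profile over the finite scar-carrying levels. -/
theorem critRate_eq_iInf_levelCrit (h : scarClasses.Nonempty) :
    critRate = sInf {c | ∃ I : ℝ≥0∞, I < ⊤ ∧ (levelRates I).Nonempty ∧ c = levelCrit I} := by
  obtain ⟨M, hM⟩ := h
  have hbdd : BddBelow {c | ∃ I : ℝ≥0∞, I < ⊤ ∧ (levelRates I).Nonempty ∧ c = levelCrit I} :=
    ⟨critRate, fun _ ⟨I, _, hne, hc⟩ => hc ▸ critRate_le_levelCrit hne⟩
  have hne' : {c | ∃ I : ℝ≥0∞, I < ⊤ ∧ (levelRates I).Nonempty ∧ c = levelCrit I}.Nonempty := by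
    obtain ⟨r, hr⟩ := hM
    obtain ⟨I, hI, hmem⟩ := exists_level_of_mem_singRates hr
    exact ⟨_, I, hI, ⟨_, hmem⟩, rfl⟩
  refine le_antisymm (le_csInf hne' fun _ ⟨I, _, hne, hc⟩ => hc ▸ critRate_le_levelCrit hne) ?_
  -- `critRate = sInf scarClasses` and every scar class constant bounds some level value
  refine le_csInf ⟨M, hM⟩ fun μ hμ => ?_
  obtain ⟨r, hr⟩ := hμ
  obtain ⟨I, hI, hmem⟩ := exists_level_of_mem_singRates hr
  obtain ⟨U, P, H, y, hAB, hy, rfl⟩ := hr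
  exact (csInf_le hbdd ⟨I, hI, ⟨_, hmem⟩, rfl⟩).trans
    ((levelCrit_le hmem).trans ((towerObj_of_abTower hAB).tightRate_le y))

/-- ★★★ **S6c. THE SUMMIT OBJECT.**  If `ScarEnvelopeTypeI` (23843) fails then at the (finite)
energy level `I₀` of the violating tower there is an EXACTLY-CRITICAL ENEMY: a root object of class
`M_c(I₀) ∈ [ε_L, M]`, of level `≤ I₀`, singular at the origin, every scar of which is tight-rated
EXACTLY `M_c(I₀)` — and no A–B object of level `≤ I₀` (in any class) has a scar rated below
`M_c(I₀)`.  ((S∞) of ROUNDS 35–37, unconditionally, inside the energy level of the counterexample.) -/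
theorem exactCritical_of_not_scarEnvelopeTypeI
    (h : ¬ Summit.NavierStokesRegularity.NavierStokesRegularity.Theses.TypeIQuarterGate.ScarEnvelopeTypeI) :
    ∃ (M : ℝ) (I₀ : ℝ≥0∞), I₀ < ⊤ ∧ (levelRates I₀).Nonempty ∧ levelCrit I₀ ∈ Icc epsL M ∧
      (∃ n : TNode, RootObj (levelCrit I₀) n ∧ n.level ≤ I₀ ∧
        ∀ y : (EuclideanSpace ℝ (Fin 3)), ¬ RegPt n.U y → tightRate n.U y = levelCrit I₀) ∧
      ∀ r ∈ levelRates I₀, levelCrit I₀ ≤ r := by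
  obtain ⟨M, hne, -, -⟩ := etaCritical_of_not_scarEnvelopeTypeI h
  obtain ⟨r, hr⟩ := hne
  obtain ⟨I₀, hI₀, hmem⟩ := exists_level_of_mem_singRates hr
  obtain ⟨U, P, H, y, hAB, hy, rfl⟩ := hr
  refine ⟨M, I₀, hI₀, ⟨_, hmem⟩,
    ⟨epsL_le_levelCrit ⟨_, hmem⟩, (levelCrit_le hmem).trans ((towerObj_of_abTower hAB).tightRate_le y)⟩,
    levelCrit_exact hI₀ ⟨_, hmem⟩, fun r hr => levelCrit_le hr⟩

end Level

end Summit.NavierStokesRegularity.NavierStokesRegularity.Cruxes.ScarEnvelopeTypeI.ZoomDictionary
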